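import Literature.MathematicalPhysics.QuantumFieldTheory.Balaban1983to89.B14RegularSpaces234Gauge
import Literature.MathematicalPhysics.QuantumFieldTheory.Balaban1983to89.B14RegularSpaces234Inner

/-!
# `Balaban1983to89.B14Space343` — T. Bałaban, *Convergent renormalization expansions for lattice gauge theories*,
Commun. Math. Phys. **119** (1988) 243–285 [Balaban1988Convergent]: the analyticity space (3.43) p. 276,
`Ũ^c_{k+1}(Y, (1+β)α̃₀, (1+β)α̃₁) × {A : supp A ⊂ Y∩Λ^{(k)*}_{k+1}, |A| < C₁p₁(g_k)}`, as ONE concrete set over the landed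
multi-scale spaces `B14RegularSpaces234.space234`; PROVED: the original space times the `A`-ball is contained in it (p. 262 / p. 276),
monotonicity, invariance under `G`-valued gauge transformations (the variables `𝐉, A` transform by the adjoint representation, p. 261),
non-vacuity

HONEST FRAMING (cell `lit-balaban`, verbatim): statement-level skeleton of published theorems with citation tags; proofs where landed; nothing here is a claim about the Yang–Mills mass gap.

PDF held: `paper:balaban1988-cmp119-convergent-renormalization` (journal page = PDF page + 242); read from the text layer of PDF pp. 34–35
(pp. 276–277), pp. 19–20 (pp. 261–262) and p. 4 (p. 246) (`lit read … --pages`), cross-checked against the gen-3 readings of the same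
seat recorded in `B14RegularSpaces234`.

WHAT IS REPRODUCED.  SKELETON row `B14.Eq3.43` («(3.43) + pp.275–277 (covers, Lemmas 5–6 [I])», owner r11): until now the row was carried by
the radii arithmetic of `B14Radii` (p. 277 «powers of 1/2», PROVED) and, since p247008, by `B14RegularSpaces234.space234_subset_enlarged`; the
SPACE (3.43) itself had no declaration (r11 ROWS-B14 v1.16: «(3.43) is now one line over `space234`»).  This file types that line and proves
its elementary members.  NOT reproduced (a claim by reference, not a display): «we obtain Lemmas 5, 6 [I] with the corresponding changes» —
'Lemmas 5, 6 [I]' = [Balaban1988RG2Cluster] Lemmas 1, 2 (rows `B13.Lem1`, `B13.Lem2`, typed-existing over `B13.StepData`).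

THE PRINT, verbatim.  p. 276: *«The same remarks apply to the expression 𝐏^{(k)}, and we obtain Lemmas 5, 6 [I] with the corresponding
changes. More precisely, the terms of the expansion (I.6.41), with localization domains Y contained in Λ_{k+1}, satisfy exactly all the
conditions of those lemmas. The remaining terms satisfy such conditions also, but with analyticity space (I.6.34) replaced by the space
Ũ^c_{k+1}(Y, (1+β)α̃₀, (1+β)α̃₁) × {A : supp A ⊂ Y∩Λ^{(k)*}_{k+1}, |A| < C₁p₁(g_k)}. (3.43)  Notice also that the localization domains
occurring in this expansion have nonempty intersections with Λ_{k+1}. These remaining terms will contribute to the boundary terms 𝐁^{(k+1)}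
in the final expansion. … Terms of this expansion can be extended [as in (I.3.13)] to analytic functions defined on the corresponding spaces
(3.43).»*  p. 261 (the properties of the localized boundary terms): *«(ii) it has an extension to an analytic function on the space
Ũ^c_j(X, α̃₀, α̃₁); (iii) the extended function is invariant with respect to (G-valued) gauge transformations of 𝐔, 𝐉, A (the variables
𝐉, A are transformed by the adjoint representation of the gauge transformations)»*; *«The spaces defined above are invariant with respect to
G-valued gauge transformations.»*  p. 262: *«the newly created expressions E^{(k)}, 𝐑^{(k)}, 𝐁^{(k)} are defined on slightly larger spaces,
with the coefficients in their definition bigger by β multiplied by a corresponding number»*.  p. 246: *«ε₀ = g₀p₀(g₀),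
p₀(g₀) = A₀(log g₀⁻²)^{p₀}»*, *«ε₁ = g₁p₁(g₁)»* (the profile `p₁` is of the same form, `Setup.p0Profile`).

THE TYPING (carriers OF RECORD, nothing re-declared).  The first factor of (3.43) IS `B14RegularSpaces234.space234 𝓜 F c ((1+β)·α̃₀)
((1+β)·α̃₁)` for the multi-scale frame `F` of `Y` at `j = k+1` and `β = c.β` (the `β` of (2.34)–(2.39): «bigger by β multiplied by a
corresponding number», here the number `1`).  The second factor is the set `fieldBall S r` of bond fields `A : PBond P i → 𝔸` (same
lattice level and value algebra as `𝐉`) with «supp A ⊂ S» (`A = 0` off `S`) and «|A| < r» on `S`; GEOMETRY AS DATA (DIVERGENCE F5): the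
bond set `S = Y∩Λ^{(k)*}_{k+1}` is a parameter, and so is the radius `r = C₁p₁(g_k)` (its printed form is `rad343`).  The print puts no
value clause on `A` (the fluctuation field is `𝔤`-valued; its analytic extension is not qualified in print), so none is typed.  The
gauge action on the triple `(𝐔, 𝐉, A)` is `act343 u = (B12RegularSpaces111.act u, B12RegularSpaces111.adJ u)` («the variables 𝐉, A are
transformed by the adjoint representation»).  PROVED here: `mem_space343_iff`, `space234_prod_subset_space343` (the original space times the
ball lies in (3.43) — `space234_subset_enlarged`), `space343_mono` (in the sequences and the radius), `fieldBall_adJ_iff`/`act343_mem_space343_iff`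
(invariance under `G`-valued gauge transformations, hypotheses as in `B14RegularSpaces234Gauge.act_mem_space234_iff`), `zero_mem_fieldBall`,
`unitTriple_mem_space343` (non-vacuity).  NOT here: analyticity of anything, the sets `Λ^{(k)*}_{k+1}` (row B14.Eq2.2), Lemmas 5, 6 [I].  No
`Prop` placeholder, no new fact; axioms standard.  Unit `lit-balaban-p07` (Phase-2 seat p07 gen 4; TAKING line HOME/STATUS.md
2026-08-21T04:15:06Z), HOME `run/shared/lean/pub/lit-balaban/`.
-/

namespace Literature.MathematicalPhysics.QuantumFieldTheory.Balaban1983to89.B14Space343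

open Literature.MathematicalPhysics.QuantumFieldTheory.Balaban1983to89
open Literature.MathematicalPhysics.QuantumFieldTheory.Balaban1983to89.B12RegularSpaces111
open Literature.MathematicalPhysics.QuantumFieldTheory.Balaban1983to89.B12RegularSpaces111Gauge
open Literature.MathematicalPhysics.QuantumFieldTheory.Balaban1983to89.B14RegularSpaces234
open Literature.MathematicalPhysics.QuantumFieldTheory.Balaban1983to89.B14RegularSpaces234Gauge
open Literature.MathematicalPhysics.QuantumFieldTheory.Balaban1983to89.B14RegularSpaces234Inner

noncomputable section

/-! ## §1. The `A`-factor: `{A : supp A ⊂ S, |A| < r}` and the printed radius `C₁p₁(g_k)` -/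

section Ball

variable {P : Params} {i : ℕ} {𝔸 : Type*} [NormedRing 𝔸]

/-- The second factor of (3.43): bond fields `A` with «supp A ⊂ S» (`A = 0` off the bond set `S`, in print `S = Y∩Λ^{(k)*}_{k+1}`) and
«|A| < r» on `S` (in print `r = C₁p₁(g_k)`). [cite: Balaban1988Convergent, (3.43) p.276] -/
def fieldBall (S : Set (PBond P i)) (r : ℝ) : Set (PBond P i → 𝔸) :=
  {A | (∀ b, b ∉ S → A b = 0) ∧ ∀ b ∈ S, ‖A b‖ < r}

/-- Membership in the `A`-factor, unfolded. [cite: Balaban1988Convergent, (3.43) p.276] -/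
theorem mem_fieldBall_iff {S : Set (PBond P i)} {r : ℝ} (A : PBond P i → 𝔸) :
    A ∈ fieldBall S r ↔ (∀ b, b ∉ S → A b = 0) ∧ ∀ b ∈ S, ‖A b‖ < r :=
  Iff.rfl

/-- On the ball every value is bounded by the radius, on and off the support (`r > 0`). [cite: Balaban1988Convergent, (3.43) p.276] -/
theorem norm_lt_of_mem_fieldBall {S : Set (PBond P i)} {r : ℝ} (hr : 0 < r) {A : PBond P i → 𝔸} (hA : A ∈ fieldBall S r)
    (b : PBond P i) : ‖A b‖ < r := by
  by_cases hb : b ∈ S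
  · exact hA.2 b hb
  · rw [hA.1 b hb, norm_zero]
    exact hr

/-- The `A`-ball is monotone in the radius. [cite: Balaban1988Convergent, (3.43) p.276] -/
theorem fieldBall_mono (S : Set (PBond P i)) {r r' : ℝ} (h : r ≤ r') : (fieldBall S r : Set (PBond P i → 𝔸)) ⊆ fieldBall S r' :=
  fun _ hA => ⟨hA.1, fun b hb => (hA.2 b hb).trans_le h⟩

/-- `A = 0` lies in the ball for `r > 0` (non-vacuity of the second factor). [cite: Balaban1988Convergent, (3.43) p.276] -/
theorem zero_mem_fieldBall (S : Set (PBond P i)) {r : ℝ} (hr : 0 < r) : (0 : PBond P i → 𝔸) ∈ fieldBall S r :=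
  ⟨fun _ _ => rfl, fun _ _ => by rw [Pi.zero_apply, norm_zero]; exact hr⟩

/-- The printed radius of the `A`-factor: `C₁p₁(g_k)` with the profile `p₁(g) = A₁(log g⁻²)^{p₁}` of p. 246 («ε₁ = g₁p₁(g₁)», of the same
form as «p₀(g₀) = A₀(log g₀⁻²)^{p₀}» = `Setup.p0Profile`). [cite: Balaban1988Convergent, (3.43) p.276] -/
def rad343 (C₁ A₁ : ℝ) (p₁ : ℕ) (g : ℝ) : ℝ := C₁ * p0Profile A₁ p₁ g

/-- `rad343` unfolded to the printed letters. [cite: Balaban1988Convergent, (3.43) p.276] -/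
theorem rad343_eq (C₁ A₁ : ℝ) (p₁ : ℕ) (g : ℝ) : rad343 C₁ A₁ p₁ g = C₁ * (A₁ * (Real.log (g ^ 2)⁻¹) ^ p₁) := rfl

end Ball

/-! ## §2. The space (3.43) -/

section Space

variable {P : Params} {i : ℕ} {𝔸 : Type*} [NormedRing 𝔸] [NormedAlgebra ℂ 𝔸] [CompleteSpace 𝔸]
variable (𝓜 : Model 𝔸)

/-- **The space (3.43)**: `Ũ^c_{k+1}(Y, (1+β)α̃₀, (1+β)α̃₁) × {A : supp A ⊂ Y∩Λ^{(k)*}_{k+1}, |A| < C₁p₁(g_k)}` — the multi-scale space of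
(2.34)–(2.39) (`B14RegularSpaces234.space234`) for the frame `F` of `Y` at `j = k+1`, with BOTH sequences enlarged by the factor `1 + β`
(`β = c.β`, the `β` of (2.34)–(2.39)), times the `A`-ball over the bond set `S` («Y∩Λ^{(k)*}_{k+1}», data) of radius `r` («C₁p₁(g_k)»,
`rad343`). [cite: Balaban1988Convergent, (3.43) p.276] -/
def space343 (F : MSFrame P i 𝔸) (c : MSConsts) (α₀ α₁ : ℕ → ℝ) (S : Set (PBond P i)) (r : ℝ) :
    Set (FieldPair P i 𝔸ˣ 𝔸 × (PBond P i → 𝔸)) :=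
  space234 𝓜 F c (fun n => (1 + c.β) * α₀ n) (fun n => (1 + c.β) * α₁ n) ×ˢ fieldBall S r

variable {𝓜}

/-- Membership in (3.43) IS: `(𝐔, 𝐉)` satisfies (i)–(iii) of p. 261 with the sequences `(1+β)α̃₀, (1+β)α̃₁`, and `A` lies in the ball.
[cite: Balaban1988Convergent, (3.43) p.276] -/
theorem mem_space343_iff {F : MSFrame P i 𝔸} {c : MSConsts} {α₀ α₁ : ℕ → ℝ} {S : Set (PBond P i)} {r : ℝ}
    (Ψ : FieldPair P i 𝔸ˣ 𝔸 × (PBond P i → 𝔸)) :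
    Ψ ∈ space343 𝓜 F c α₀ α₁ S r ↔
      Satisfies234 𝓜 F c (fun n => (1 + c.β) * α₀ n) (fun n => (1 + c.β) * α₁ n) Ψ.1 ∧ Ψ.2 ∈ fieldBall S r :=
  Iff.rfl

/-- The first projection of (3.43) is the enlarged multi-scale space. [cite: Balaban1988Convergent, (3.43) p.276] -/
theorem fst_mem_of_mem_space343 {F : MSFrame P i 𝔸} {c : MSConsts} {α₀ α₁ : ℕ → ℝ} {S : Set (PBond P i)} {r : ℝ}
    {Ψ : FieldPair P i 𝔸ˣ 𝔸 × (PBond P i → 𝔸)} (h : Ψ ∈ space343 𝓜 F c α₀ α₁ S r) :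
    Ψ.1 ∈ space234 𝓜 F c (fun n => (1 + c.β) * α₀ n) (fun n => (1 + c.β) * α₁ n) :=
  h.1

/-- **The original space times the ball lies in (3.43)**: `Ũ^c_{k+1}(Y, α̃₀, α̃₁) × {A : …} ⊆ (3.43)` — «defined on slightly larger spaces, with
the coefficients in their definition bigger by β multiplied by a corresponding number» (p. 262); for `0 ≤ β ≤ 1`, `L, ξ > 0`, `BCM ≥ 0` and
nonnegative sequences (`B14RegularSpaces234.space234_subset_enlarged`). [cite: Balaban1988Convergent, (3.43) p.276] -/
theorem space234_prod_subset_space343 {F : MSFrame P i 𝔸} {c : MSConsts} (h0 : 0 ≤ c.β) (h1 : c.β ≤ 1) (hL : 0 < c.L)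
    (hξ : 0 < c.ξ) (hBCM : 0 ≤ c.B * c.C * c.M) {α₀ α₁ : ℕ → ℝ} (hα₀ : ∀ n, 0 ≤ α₀ n) (hα₁ : ∀ n, 0 ≤ α₁ n)
    (S : Set (PBond P i)) (r : ℝ) :
    space234 𝓜 F c α₀ α₁ ×ˢ fieldBall S r ⊆ space343 𝓜 F c α₀ α₁ S r :=
  Set.prod_mono (space234_subset_enlarged h0 h1 hL hξ hBCM hα₀ hα₁ h0) le_rfl

/-- (3.43) is monotone in the sequences `α̃₀, α̃₁` (pointwise) and in the radius `r` (`0 ≤ β ≤ 1`, `L, ξ > 0`, `BCM ≥ 0`).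
[cite: Balaban1988Convergent, (3.43) p.276] -/
theorem space343_mono {F : MSFrame P i 𝔸} {c : MSConsts} (h0 : 0 ≤ c.β) (h1 : c.β ≤ 1) (hL : 0 < c.L) (hξ : 0 < c.ξ)
    (hBCM : 0 ≤ c.B * c.C * c.M) {α₀ α₀' α₁ α₁' : ℕ → ℝ} (hα₀ : ∀ n, α₀ n ≤ α₀' n) (hα₁ : ∀ n, α₁ n ≤ α₁' n)
    (S : Set (PBond P i)) {r r' : ℝ} (hr : r ≤ r') :
    space343 𝓜 F c α₀ α₁ S r ⊆ space343 𝓜 F c α₀' α₁' S r' := by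
  have hβ : 0 ≤ 1 + c.β := by linarith
  exact Set.prod_mono
    (space234_mono h0 h1 hL hξ hBCM (fun n => mul_le_mul_of_nonneg_left (hα₀ n) hβ)
      (fun n => mul_le_mul_of_nonneg_left (hα₁ n) hβ))
    (fieldBall_mono S hr)

end Space

/-! ## §3. `G`-valued gauge transformations of `(𝐔, 𝐉, A)`: «the variables 𝐉, A are transformed by the adjoint representation» -/

section Gauge

variable {P : Params} {i : ℕ} {𝔸 : Type*} [NormedRing 𝔸]

/-- The gauge action on the triples `(𝐔, 𝐉, A)` of (3.43): `(𝐔, 𝐉)` by (I.1.10) (`B12RegularSpaces111.act`) and `A ↦ R(u)A = R(u₋)A`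
(«the variables 𝐉, A are transformed by the adjoint representation of the gauge transformations», p. 261 (iii)).
[cite: Balaban1988Convergent, (2.41) p.261] -/
def act343 (u : Site P i → 𝔸ˣ) (Ψ : FieldPair P i 𝔸ˣ 𝔸 × (PBond P i → 𝔸)) : FieldPair P i 𝔸ˣ 𝔸 × (PBond P i → 𝔸) :=
  (act u Ψ.1, adJ u Ψ.2)

/-- The components of the action on triples. [cite: Balaban1988Convergent, (2.41) p.261] -/
theorem act343_fst (u : Site P i → 𝔸ˣ) (Ψ : FieldPair P i 𝔸ˣ 𝔸 × (PBond P i → 𝔸)) : (act343 u Ψ).1 = act u Ψ.1 := rfl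

/-- The components of the action on triples. [cite: Balaban1988Convergent, (2.41) p.261] -/
theorem act343_snd (u : Site P i → 𝔸ˣ) (Ψ : FieldPair P i 𝔸ˣ 𝔸 × (PBond P i → 𝔸)) : (act343 u Ψ).2 = adJ u Ψ.2 := rfl

/-- `R(u)A` vanishes exactly where `A` does (conjugation by a unit). [folklore] -/
private theorem adJ_apply_eq_zero_iff (u : Site P i → 𝔸ˣ) (A : PBond P i → 𝔸) (b : PBond P i) : adJ u A b = 0 ↔ A b = 0 := by
  refine ⟨fun h => ?_, fun h => by simp [adJ, h]⟩
  have h' : (↑(u b.src)⁻¹ : 𝔸) * ((u b.src : 𝔸) * A b * ↑(u b.src)⁻¹) * (u b.src : 𝔸) = 0 := by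
    rw [show (u b.src : 𝔸) * A b * ↑(u b.src)⁻¹ = adJ u A b from rfl, h, mul_zero, zero_mul]
  simpa only [mul_assoc, Units.inv_mul_cancel_left, Units.inv_mul, mul_one] using h'

/-- **The `A`-ball is invariant under `G`-valued gauge transformations**: the support is preserved (conjugation by a unit) and the norm is
preserved (`‖·‖ ≤ 1` on `G`: isometry of the adjoint action, `B12RegularSpaces111Gauge.norm_conj_eq`). [cite: Balaban1988Convergent, (3.43) p.276] -/
theorem fieldBall_adJ_iff {G : Subgroup 𝔸ˣ} (hG1 : ∀ g ∈ G, ‖(g : 𝔸)‖ ≤ 1) {v : Site P i → 𝔸ˣ} (hv : ∀ x, v x ∈ G)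
    (S : Set (PBond P i)) (r : ℝ) (A : PBond P i → 𝔸) : adJ v A ∈ fieldBall S r ↔ A ∈ fieldBall S r := by
  simp only [mem_fieldBall_iff, adJ_apply_eq_zero_iff]
  refine and_congr Iff.rfl (forall₂_congr fun b _ => ?_)
  rw [show adJ v A b = (v b.src : 𝔸) * A b * ↑(v b.src)⁻¹ from rfl, norm_conj_eq hG1 (hv b.src)]

variable [NormedAlgebra ℂ 𝔸] [CompleteSpace 𝔸] {𝓜 : Model 𝔸}

/-- **(3.43) is invariant under `G`-valued gauge transformations of `(𝐔, 𝐉, A)`** (p. 261: «The spaces defined above are invariant with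
respect to G-valued gauge transformations», «the variables 𝐉, A are transformed by the adjoint representation»): for `G`-valued `v`,
`(𝐔, 𝐉, A)^v ∈ (3.43) ↔ (𝐔, 𝐉, A) ∈ (3.43)` — the first factor by `B14RegularSpaces234Gauge.act_mem_space234_iff` (hypotheses: `‖·‖ ≤ 1` on
`G`, `G ≤ Gᶜ`, `𝔤ᶜ` `Ad(G)`-stable, gauge covariance of the data `U_{p,X}(M˙(·))`, `𝐉_{p,X}(M˙(·))` of (i)), the second by `fieldBall_adJ_iff`.
[cite: Balaban1988Convergent, (3.43) p.276] -/
theorem act343_mem_space343_iff (hG1 : ∀ g ∈ 𝓜.G, ‖(g : 𝔸)‖ ≤ 1) (hGc : 𝓜.G ≤ 𝓜.Gc)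
    (hgc : ∀ g ∈ 𝓜.G, ∀ X ∈ 𝓜.gc, (g : 𝔸) * X * ↑g⁻¹ ∈ 𝓜.gc) {F : MSFrame P i 𝔸} {c : MSConsts} {α₀ α₁ : ℕ → ℝ}
    (hUp : ∀ (v : Site P i → 𝔸ˣ), (∀ x, v x ∈ 𝓜.G) → ∀ p (V : PBond P i → 𝔸ˣ), ∃ w : Site P (F.bg.lvl p) → 𝔸ˣ,
      (∀ x, w x ∈ 𝓜.G) ∧ F.bg.Up p (gaugeU v V) = gaugeU w (F.bg.Up p V))
    (hJp : ∀ (v : Site P i → 𝔸ˣ), (∀ x, v x ∈ 𝓜.G) → ∀ p (V : PBond P i → 𝔸ˣ) b,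
      ‖F.bg.Jp p (gaugeU v V) b‖ = ‖F.bg.Jp p V b‖)
    {S : Set (PBond P i)} {r : ℝ} (Ψ : FieldPair P i 𝔸ˣ 𝔸 × (PBond P i → 𝔸)) {v : Site P i → 𝔸ˣ} (hv : ∀ x, v x ∈ 𝓜.G) :
    act343 v Ψ ∈ space343 𝓜 F c α₀ α₁ S r ↔ Ψ ∈ space343 𝓜 F c α₀ α₁ S r := by
  simp only [mem_space343_iff, act343_fst, act343_snd]
  rw [← mem_space234_iff, ← mem_space234_iff, act_mem_space234_iff hG1 hGc hgc hUp hJp Ψ.1 hv,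
    fieldBall_adJ_iff hG1 hv]

end Gauge

/-! ## §4. Non-vacuity -/

section NonVacuity

variable {P : Params} {i : ℕ} {𝔸 : Type*} [NormedRing 𝔸] [NormedAlgebra ℂ 𝔸] [CompleteSpace 𝔸]
variable {𝓜 : Model 𝔸}

/-- **(3.43) is non-empty**: the triple `(𝐔, 𝐉, A) = (1, 0, 0)` lies in it for `0 ≤ β < 1`, positive sequences, `L, ξ > 0`, `BCM > 0`, `r > 0`,
as soon as the data of (i) send the unit configuration to unit / zero configurations (`B14RegularSpaces234Inner.unitPair_mem_space234` for the
first factor, `zero_mem_fieldBall` for the second). [cite: Balaban1988Convergent, (3.43) p.276] -/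
theorem unitTriple_mem_space343 (F : MSFrame P i 𝔸) {c : MSConsts} (h0 : 0 ≤ c.β) (h1 : c.β < 1) (hL : 0 < c.L)
    (hξ : 0 < c.ξ) (hBCM : 0 < c.B * c.C * c.M) {α₀ α₁ : ℕ → ℝ} (hα₀ : ∀ n, 0 < α₀ n) (hα₁ : ∀ n, 0 < α₁ n)
    (hUp : ∀ p, F.bg.Up p 1 = 1) (hJp : ∀ p b, F.bg.Jp p 1 b = 0) (S : Set (PBond P i)) {r : ℝ} (hr : 0 < r) :
    ((B12RegularSpaces111Mono.unitPair, 0) : FieldPair P i 𝔸ˣ 𝔸 × (PBond P i → 𝔸)) ∈ space343 𝓜 F c α₀ α₁ S r := by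
  have hβ : 0 < 1 + c.β := by linarith
  exact ⟨unitPair_mem_space234 F h0 h1 hL hξ hBCM (fun n => mul_pos hβ (hα₀ n)) (fun n => mul_pos hβ (hα₁ n)) hUp hJp,
    zero_mem_fieldBall S hr⟩

end NonVacuity

end

end Literature.MathematicalPhysics.QuantumFieldTheory.Balaban1983to89.B14Space343
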